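import Mathlib.Algebra.Lie.OfAssociative
import Mathlib.Algebra.Lie.Subalgebra
import Literature.NumberTheory.Automorphic.LieAlgebraGLStabilizer
import Literature.NumberTheory.Automorphic.BigCellOpen
import HarnessLib

/-!
# `Lie(G)` as a Lie subalgebra of `𝔤𝔩ₙ`; `Lie(T)` is central in the fixed points of `Ad(T)`
(trunk T-AUTOMORPHIC, G25 AutomorphicL; Springer, *Linear Algebraic Groups*, 4.4.5, 4.4.10 (3), 4.4.15)

Companion to `LieAlgebraGL.lean` (the subspace `lieAlgebraGL G ⊆ 𝔤𝔩ₙ = Matrix n n k`, the weight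
spaces `weightSpaceGL T χ`, `lieWeightSpace G T χ = Lie(G) ∩ (𝔤𝔩ₙ)_χ`), `LieAlgebraGLStabilizer.lean`
(`lie_mem_of_forall_conj_mem`: `Lie(H)` normalises what `H` normalises; the differential
`tangentDeriv_conjConstPolyGL` of `g ↦ g M g⁻¹`) and `BigCellOpen.lean`
(`conj_eq_self_of_mem_lieAlgebraGL`: a commutative `T` acts trivially on `Lie(T)`), namespace
`Literature.NumberTheory.Automorphic`. It records the bracket structure that the subspace-valued
`lieAlgebraGL` left out:

* `lie_mem_lieAlgebraGL` — `Lie(G)` is closed under the commutator `A B - B A` of `𝔤𝔩ₙ`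
  (Springer 4.4.5 (ii) with 4.4.15: `Ad(G)` preserves `L(G)`, hence so does `ad = d Ad`), and
  **`lieSubalgebraGL G`**, the same space as a Mathlib `LieSubalgebra k (Matrix n n k)` (bracket
  `⁅A, B⁆ = A B - B A`, `Ring.lie_def`), so that Mathlib's Lie theory (Engel, Cartan, weights)
  applies to `Lie(G)`;
* `lie_eq_zero_of_mem_lieAlgebraGL_of_forall_conj_eq` — if `t M t⁻¹ = M` for all `t ∈ T` then
  `[H, M] = 0` for all `H ∈ Lie(T)` (the differential of the constant map `t ↦ t M t⁻¹`);
  hence **`lie_eq_zero_of_mem_lieAlgebraGL_of_mem_weightSpaceGL_one`**: `Lie(T)` centralises the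
  fixed space `(𝔤𝔩ₙ)^T = weightSpaceGL T 1` of `Ad(T)`, and `Lie(T)` is abelian for commutative
  `T` (`lie_eq_zero_of_mem_lieAlgebraGL_torus`, using `conj_eq_self_of_mem_lieAlgebraGL`);
* `lieAlgebraGL_le_lieWeightSpace_one` — `Lie(T) ⊆ 𝔤^T = lieWeightSpace G T 1` for a commutative
  `T ≤ G`; `mul_comm_of_mem_weightSpaceGL_one` — elements of `(𝔤𝔩ₙ)^T` commute with `T`.

## Mathlib

`LieSubalgebra`, `LieRing.ofAssociativeRing` (the commutator bracket on `Matrix n n k`,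
`Ring.lie_def`). Mathlib has no Lie algebra *of an algebraic group*; nothing here duplicates a
Mathlib or Literature declaration (searched `lieSubalgebraGL`, `lie_mem_lieAlgebraGL`).

## References

* T. A. Springer, *Linear Algebraic Groups*, 2nd ed., Progress in Mathematics 9, Birkhäuser
  (1998), 4.4.5 (ii), 4.4.10 (3), 4.4.15 [SpringerLAG1998].
-/

noncomputable section

/-! The commutator bracket on the associative algebra `Matrix n n k` (and on `Module.End`): as in
Mathlib's own Lie-theory files (`Mathlib.Algebra.Lie.OfAssociative` and its users), the reducible
non-instance `LieRing.ofAssociativeRing` is activated locally with priority `100`; it introduces no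
new data on types that already carry a `LieRing`. -/
attribute [local instance 100] LieRing.ofAssociativeRing

namespace Literature.NumberTheory.Automorphic

variable {k : Type*} [Field k] {n : Type*} [Fintype n] [DecidableEq n]

/-! ### `Lie(G)` is a Lie subalgebra of `𝔤𝔩ₙ` -/

section Subalgebra

variable {G : Subgroup (GL n k)}

/-- **`Lie(G)` is closed under the commutator** `[A, B] = A B - B A` of `𝔤𝔩ₙ` (Springer 4.4.5
(ii): `Ad(g) L(G) = L(G)` for `g ∈ G`, and 4.4.15: `d Ad = ad`; here `lie_mem_of_forall_conj_mem`
with `L = L(G)`). [cite: SpringerLAG1998, 4.4.5 (ii) and 4.4.15] -/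
theorem lie_mem_lieAlgebraGL {A B : Matrix n n k} (hA : A ∈ lieAlgebraGL G)
    (hB : B ∈ lieAlgebraGL G) : A * B - B * A ∈ lieAlgebraGL G :=
  lie_mem_of_forall_conj_mem (fun _ hg _ hM => conj_mem_lieAlgebraGL hg hM) hA hB

variable (G) in
/-- **The Lie algebra `Lie(G) ⊆ 𝔤𝔩ₙ` of `G ≤ GL n k` as a Lie subalgebra** of Mathlib's Lie algebra
`Matrix n n k` (commutator bracket; Springer 4.4.10 (3): `L(GL_n) = 𝔤𝔩ₙ` with `[X, Y] = XY - YX`,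
and `L(G)` is a subalgebra, 4.4.7). The underlying subspace is `lieAlgebraGL G`. [cite: SpringerLAG1998, 4.4.7 and 4.4.10 (3)] -/
def lieSubalgebraGL : LieSubalgebra k (Matrix n n k) :=
  { lieAlgebraGL G with
    lie_mem' := fun {A B} hA hB => by
      change A * B - B * A ∈ lieAlgebraGL G
      exact lie_mem_lieAlgebraGL hA hB }

/-- Membership in `lieSubalgebraGL G` is membership in `lieAlgebraGL G`. [folklore] -/
@[simp] lemma mem_lieSubalgebraGL_iff {A : Matrix n n k} :
    A ∈ lieSubalgebraGL G ↔ A ∈ lieAlgebraGL G := Iff.rfl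

/-- The underlying submodule of `lieSubalgebraGL G`. [folklore] -/
@[simp] lemma lieSubalgebraGL_toSubmodule : (lieSubalgebraGL G).toSubmodule = lieAlgebraGL G := rfl

end Subalgebra

/-! ### `Lie(T)` centralises the fixed points of `Ad(T)` -/

section Centralizer

variable {T : Subgroup (GL n k)}

/-- **The differential of a constant conjugation orbit vanishes**: if `t M t⁻¹ = M` for all `t ∈ T`
then `H M - M H = 0` for every `H ∈ Lie(T)` — the polynomials `(x M x⁻¹)_{ij} - M_{ij}` vanish on
`T`, and their differentials at `1` along `H` are the entries of `[H, M]`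
(`tangentDeriv_conjConstPolyGL`; Springer 4.4.15, `d Ad = ad`). [cite: SpringerLAG1998, 4.4.15] -/
theorem lie_eq_zero_of_mem_lieAlgebraGL_of_forall_conj_eq {M : Matrix n n k}
    (hM : ∀ t ∈ T, (t : Matrix n n k) * M * ((t⁻¹ : GL n k) : Matrix n n k) = M) {H : Matrix n n k}
    (hH : H ∈ lieAlgebraGL T) : H * M - M * H = 0 := by
  ext i j
  have hmem : conjConstPolyGL M i j - MvPolynomial.C (M i j) ∈
      MvPolynomial.vanishingIdeal k (glCoordFun '' (T : Set (GL n k))) := by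
    rw [MvPolynomial.mem_vanishingIdeal_iff]
    rintro _ ⟨t, ht, rfl⟩
    change MvPolynomial.eval (glCoordFun t) (conjConstPolyGL M i j - MvPolynomial.C (M i j)) = 0
    rw [map_sub, eval_conjConstPolyGL, MvPolynomial.eval_C, hM t ht, sub_self]
  have h := (mem_lieAlgebraGL_iff.1 hH) _ hmem
  rwa [tangentDeriv_sub, tangentDeriv_conjConstPolyGL, tangentDeriv_C, sub_zero] at h

/-- Elements of the fixed space `(𝔤𝔩ₙ)^T = weightSpaceGL T 1` commute with the elements of `T`.
[folklore] -/
lemma mul_comm_of_mem_weightSpaceGL_one {M : Matrix n n k} (hM : M ∈ weightSpaceGL T 1) {t : GL n k}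
    (ht : t ∈ T) : (t : Matrix n n k) * M = M * (t : Matrix n n k) := by
  have h := hM ⟨t, ht⟩
  rw [MonoidHom.one_apply, Units.val_one, one_smul] at h
  have h' := congrArg (· * (t : Matrix n n k)) h
  simp only at h'
  rwa [Matrix.mul_assoc, Matrix.nonsing_inv_mul _ (Matrix.isUnits_det_units t), Matrix.mul_one]
    at h'

/-- The fixed space in the `GL`-inverse form used by `lie_eq_zero_of_mem_lieAlgebraGL_of_forall_conj_eq`.
[folklore] -/
lemma conj_eq_of_mem_weightSpaceGL_one {M : Matrix n n k} (hM : M ∈ weightSpaceGL T 1) {t : GL n k}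
    (ht : t ∈ T) : (t : Matrix n n k) * M * ((t⁻¹ : GL n k) : Matrix n n k) = M := by
  have h := hM ⟨t, ht⟩
  rwa [MonoidHom.one_apply, Units.val_one, one_smul, ← Matrix.coe_units_inv] at h

/-- **`Lie(T)` centralises `(𝔤𝔩ₙ)^T`**: `[H, M] = 0` for `H ∈ Lie(T)` and `M` fixed by `Ad(T)`.
[cite: SpringerLAG1998, 4.4.15] -/
theorem lie_eq_zero_of_mem_lieAlgebraGL_of_mem_weightSpaceGL_one {M : Matrix n n k}
    (hM : M ∈ weightSpaceGL T 1) {H : Matrix n n k} (hH : H ∈ lieAlgebraGL T) : H * M - M * H = 0 :=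
  lie_eq_zero_of_mem_lieAlgebraGL_of_forall_conj_eq (fun _ ht => conj_eq_of_mem_weightSpaceGL_one hM ht) hH

/-- For a commutative `T`, `Lie(T)` lies in the fixed space `(𝔤𝔩ₙ)^T` of `Ad(T)`
(`conj_eq_self_of_mem_lieAlgebraGL` of `BigCellOpen.lean`). [folklore] -/
theorem lieAlgebraGL_le_weightSpaceGL_one [IsMulCommutative ↥T] :
    lieAlgebraGL T ≤ weightSpaceGL T 1 := by
  intro A hA t
  rw [MonoidHom.one_apply, Units.val_one, one_smul, ← Matrix.coe_units_inv]
  exact conj_eq_self_of_mem_lieAlgebraGL hA t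

/-- **`Lie(T)` is abelian for a commutative `T`**: `[H, H'] = 0` for `H, H' ∈ Lie(T)`
(a torus is commutative, and so is its Lie algebra). [folklore] -/
theorem lie_eq_zero_of_mem_lieAlgebraGL_torus [IsMulCommutative ↥T] {H H' : Matrix n n k}
    (hH : H ∈ lieAlgebraGL T) (hH' : H' ∈ lieAlgebraGL T) : H * H' - H' * H = 0 :=
  lie_eq_zero_of_mem_lieAlgebraGL_of_mem_weightSpaceGL_one (lieAlgebraGL_le_weightSpaceGL_one hH') hH

variable {G : Subgroup (GL n k)}

/-- For a commutative `T ≤ G`, `Lie(T) ⊆ 𝔤^T = lieWeightSpace G T 1`, the fixed points of `Ad(T)`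
in `Lie(G)`. [folklore] -/
theorem lieAlgebraGL_le_lieWeightSpace_one [IsMulCommutative ↥T] (hTG : T ≤ G) :
    lieAlgebraGL T ≤ lieWeightSpace G T 1 :=
  le_inf (lieAlgebraGL_mono hTG) lieAlgebraGL_le_weightSpaceGL_one

/-- The fixed space `𝔤^T` is closed under the commutator. [folklore] -/
theorem lie_mem_lieWeightSpace_one {A B : Matrix n n k} (hA : A ∈ lieWeightSpace G T 1)
    (hB : B ∈ lieWeightSpace G T 1) : A * B - B * A ∈ lieWeightSpace G T 1 := by
  refine ⟨lie_mem_lieAlgebraGL hA.1 hB.1, fun t => ?_⟩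
  rw [MonoidHom.one_apply, Units.val_one, one_smul, ← Matrix.coe_units_inv, Matrix.mul_sub,
    Matrix.sub_mul]
  have hA' := conj_eq_of_mem_weightSpaceGL_one hA.2 t.2
  have hB' := conj_eq_of_mem_weightSpaceGL_one hB.2 t.2
  have hAB : ((t : GL n k) : Matrix n n k) * (A * B) * (((t : GL n k)⁻¹ : GL n k) : Matrix n n k) =
      A * B := by
    conv_rhs => rw [← hA', ← hB']
    simp only [Matrix.mul_assoc]
    rw [← Matrix.mul_assoc (((t : GL n k)⁻¹ : GL n k) : Matrix n n k), Units.inv_mul, Matrix.one_mul]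
  have hBA : ((t : GL n k) : Matrix n n k) * (B * A) * (((t : GL n k)⁻¹ : GL n k) : Matrix n n k) =
      B * A := by
    conv_rhs => rw [← hB', ← hA']
    simp only [Matrix.mul_assoc]
    rw [← Matrix.mul_assoc (((t : GL n k)⁻¹ : GL n k) : Matrix n n k), Units.inv_mul, Matrix.one_mul]
  rw [hAB, hBA]

end Centralizer

end Literature.NumberTheory.Automorphic
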